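import Mathlib
import HarnessLib
import Summits.Ventures.LatticeQCDFlow.Scoring.SU3FrobeniusDiameter

/-!
# Frobenius distances from `U ∈ SU(3)` to the centre: `‖U − ζ1‖² = 6 − 2 Re(ζ̄ tr U)`, and the three always sum to `18`

HONEST FRAMING: exact (Metropolis-corrected) sampling algorithms for lattice gauge theory;
figures of merit are autocorrelation/cost numbers at stated couplings and volumes; no
continuum-physics claim.

Venture `LatticeQCDFlow` (cell pub-lqcd), sub-topic `Scoring`; FANOUT row 21 (`su3-base`: the 4D
`SU(3)` baselines).  NEW WORK of the cell (placement rule), elementary, over row 21 GEN-8's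
`Scoring/SU3FrobeniusDiameter` (`su3_frobeniusDistSq_eq`: `Σ|Uᵢⱼ − Vᵢⱼ|² = 6 − 2 Re tr(U V⁻¹)`;
diameter `9`, attained at non-trivial centre translates).  No definition is introduced; nothing is
cited as a fact; no number of ours.

The `Z₃` SECTOR of an `SU(3)` element (as used for Polyakov-loop-type diagnostics) is "the nearest
centre element".  With `V = ζ·1`, `ζ³ = 1`, the distance formula reads

  `Σᵢⱼ |Uᵢⱼ − ζδᵢⱼ|² = 6 − 2 Re(ζ̄ · tr U)`,

so the nearest centre element is the `ζ` maximising `Re(ζ̄ tr U)` — the sector is read off the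
TRACE alone — and, since `1 + ζ + ζ² = 0` for `ζ ≠ 1`, the three squared distances always sum to
`18 − 2 Re((1 + ζ̄ + ζ̄²) tr U) = 18`.

## What is proved (`ζ : ℂ`, `ζ ^ 3 = 1`)

* **`su3_frobeniusDistSq_centre_eq`** — `Σ|Uᵢⱼ − (ζ•1)ᵢⱼ|² = 6 − 2 Re(ζ̄ tr U)`;
* `su3_frobeniusDistSq_one_eq` — `ζ = 1`: `Σ|Uᵢⱼ − δᵢⱼ|² = 6 − 2 Re tr U` (twice the Wilson density);
* `su3_frobeniusDistSq_centre_lt_iff` — nearer to `ζ1` than to `ζ'1` iff `Re(ζ̄' tr U) < Re(ζ̄ tr U)`;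
* **`su3_sum_frobeniusDistSq_centre`** — for `ζ ≠ 1`: the distances² to `1, ζ1, ζ²1` sum to `18`.

NOT CLAIMED: anything about Polyakov loops proper (products around the time direction) or about
sector dynamics of any algorithm; anything for `N ≠ 3`.
-/

namespace Summit.Ventures.LatticeQCDFlow.Scoring

open Matrix
open Literature.MathematicalPhysics.QuantumLattice

section SpecialUnitaryThree

/-- **`Σᵢⱼ |Uᵢⱼ − ζ δᵢⱼ|² = 6 − 2 Re(ζ̄ · tr U)`** for `U ∈ SU(3)` and `ζ³ = 1`: the Frobenius distance
to a centre element is read off the trace. -/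
theorem su3_frobeniusDistSq_centre_eq {ζ : ℂ} (hζ : ζ ^ 3 = 1)
    (U : Matrix.specialUnitaryGroup (Fin 3) ℂ) :
    ∑ i, ∑ j, ‖(U : Matrix (Fin 3) (Fin 3) ℂ) i j - (ζ • (1 : Matrix (Fin 3) (Fin 3) ℂ)) i j‖ ^ 2
      = 6 - 2 * ((starRingEnd ℂ) ζ * (U : Matrix (Fin 3) (Fin 3) ℂ).trace).re := by
  -- the centre element `ζ • 1` lies in `SU(3)` (`|ζ| = 1`, `ζ³ = 1`)
  have hmem : ζ • (1 : Matrix (Fin 3) (Fin 3) ℂ) ∈ Matrix.specialUnitaryGroup (Fin 3) ℂ := by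
    have hn : ‖ζ‖ = 1 := by
      have h : ‖ζ‖ ^ 3 = 1 := by rw [← norm_pow, hζ, norm_one]
      exact (pow_eq_one_iff_of_nonneg (norm_nonneg ζ) (by norm_num)).mp h
    have hζc : ζ * (starRingEnd ℂ) ζ = 1 := by
      rw [mul_comm, ← Complex.normSq_eq_conj_mul_self, Complex.normSq_eq_norm_sq, hn]; norm_num
    rw [Matrix.mem_specialUnitaryGroup_iff]
    refine ⟨?_, ?_⟩
    · rw [Matrix.mem_unitaryGroup_iff, star_smul, star_one, Matrix.smul_mul, Matrix.mul_smul,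
        Matrix.one_mul, smul_smul, Complex.star_def, hζc, one_smul]
    · rw [det_smul, det_one, mul_one, Fintype.card_fin, hζ]
  have h := su3_frobeniusDistSq_eq U ⟨ζ • (1 : Matrix (Fin 3) (Fin 3) ℂ), hmem⟩
  have hre : reTr (U * (⟨ζ • (1 : Matrix (Fin 3) (Fin 3) ℂ), hmem⟩ :
      Matrix.specialUnitaryGroup (Fin 3) ℂ)⁻¹) =
      ((starRingEnd ℂ) ζ * (U : Matrix (Fin 3) (Fin 3) ℂ).trace).re := by
    change (((U : Matrix (Fin 3) (Fin 3) ℂ) * star (ζ • (1 : Matrix (Fin 3) (Fin 3) ℂ))).trace).re = _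
    rw [star_smul, star_one, Matrix.mul_smul, Matrix.mul_one, trace_smul, smul_eq_mul,
      Complex.star_def]
  rw [hre] at h
  exact h

/-- The case `ζ = 1`: **`Σᵢⱼ |Uᵢⱼ − δᵢⱼ|² = 6 − 2 Re tr U = 2 (3 − Re tr U)`** — the squared
Frobenius distance of a plaquette matrix from the identity is twice its Wilson density
`3 − Re tr U_P`. -/
theorem su3_frobeniusDistSq_one_eq (U : Matrix.specialUnitaryGroup (Fin 3) ℂ) :
    ∑ i, ∑ j, ‖(U : Matrix (Fin 3) (Fin 3) ℂ) i j - (1 : Matrix (Fin 3) (Fin 3) ℂ) i j‖ ^ 2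
      = 6 - 2 * ((U : Matrix (Fin 3) (Fin 3) ℂ).trace).re := by
  have h := su3_frobeniusDistSq_centre_eq (ζ := 1) (by norm_num) U
  rw [one_smul, map_one, one_mul] at h
  exact h

/-- The `Z₃` sector from the trace: `U` is nearer to `ζ1` than to `ζ'1` iff
`Re(ζ̄' tr U) < Re(ζ̄ tr U)`. -/
theorem su3_frobeniusDistSq_centre_lt_iff {ζ ζ' : ℂ} (hζ : ζ ^ 3 = 1) (hζ' : ζ' ^ 3 = 1)
    (U : Matrix.specialUnitaryGroup (Fin 3) ℂ) :
    ∑ i, ∑ j, ‖(U : Matrix (Fin 3) (Fin 3) ℂ) i j - (ζ • (1 : Matrix (Fin 3) (Fin 3) ℂ)) i j‖ ^ 2 <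
        ∑ i, ∑ j, ‖(U : Matrix (Fin 3) (Fin 3) ℂ) i j - (ζ' • (1 : Matrix (Fin 3) (Fin 3) ℂ)) i j‖ ^ 2 ↔
      ((starRingEnd ℂ) ζ' * (U : Matrix (Fin 3) (Fin 3) ℂ).trace).re <
        ((starRingEnd ℂ) ζ * (U : Matrix (Fin 3) (Fin 3) ℂ).trace).re := by
  rw [su3_frobeniusDistSq_centre_eq hζ, su3_frobeniusDistSq_centre_eq hζ']
  constructor <;> intro h <;> linarith

/-- **The three squared Frobenius distances from `U ∈ SU(3)` to the centre `{1, ζ1, ζ²1}` sum to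
`18`** (`ζ³ = 1`, `ζ ≠ 1`, so `1 + ζ + ζ² = 0`). -/
theorem su3_sum_frobeniusDistSq_centre {ζ : ℂ} (hζ : ζ ^ 3 = 1) (h1 : ζ ≠ 1)
    (U : Matrix.specialUnitaryGroup (Fin 3) ℂ) :
    ∑ i, ∑ j, ‖(U : Matrix (Fin 3) (Fin 3) ℂ) i j - ((1 : ℂ) • (1 : Matrix (Fin 3) (Fin 3) ℂ)) i j‖ ^ 2
      + ∑ i, ∑ j, ‖(U : Matrix (Fin 3) (Fin 3) ℂ) i j - (ζ • (1 : Matrix (Fin 3) (Fin 3) ℂ)) i j‖ ^ 2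
      + ∑ i, ∑ j, ‖(U : Matrix (Fin 3) (Fin 3) ℂ) i j - (ζ ^ 2 • (1 : Matrix (Fin 3) (Fin 3) ℂ)) i j‖ ^ 2
      = 18 := by
  have hζ2 : (ζ ^ 2) ^ 3 = 1 := by rw [← pow_mul, mul_comm, pow_mul, hζ, one_pow]
  rw [su3_frobeniusDistSq_centre_eq (by norm_num : (1 : ℂ) ^ 3 = 1),
    su3_frobeniusDistSq_centre_eq hζ, su3_frobeniusDistSq_centre_eq hζ2]
  -- `1 + ζ + ζ² = 0`
  have hs : 1 + ζ + ζ ^ 2 = 0 := by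
    have hfac : (ζ - 1) * (1 + ζ + ζ ^ 2) = ζ ^ 3 - 1 := by ring
    rw [hζ, sub_self] at hfac
    rcases mul_eq_zero.mp hfac with h | h
    · exact absurd (sub_eq_zero.mp h) h1
    · exact h
  set t := (U : Matrix (Fin 3) (Fin 3) ℂ).trace
  have hsum : (starRingEnd ℂ) 1 * t + (starRingEnd ℂ) ζ * t + (starRingEnd ℂ) (ζ ^ 2) * t = 0 := by
    rw [← add_mul, ← add_mul, ← map_add, ← map_add, hs, map_zero, zero_mul]
  have hre := congrArg Complex.re hsum
  rw [Complex.add_re, Complex.add_re, Complex.zero_re] at hre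
  linarith

end SpecialUnitaryThree

end Summit.Ventures.LatticeQCDFlow.Scoring
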